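import Mathlib
import Summits.Ventures.PercRepro2.HCov
import Summits.Ventures.PercRepro2.RootLeafUSigns
import Summits.Ventures.PercRepro2.RootLeafUYBF
import Summits.Ventures.PercRepro2.RootLeafUYBFW

/-!
# (G4-u): `(F_W)` — hence `0 ≤ T2oL` — from the tie-class statement `(MULT)`
(blind cell PercRepro2, p4 g12; proofs/P4-G12-BNEG.md, S3 v52 item (y))

RootLeafUYBFW landed `(F_W) := (Z + W)·D·M + W·Y_N·B₀ − D·B·Y ≥ 0 ⟹ (YB) ≥ 0 ⟹ 0 ≤ T2oL`
(`Z = P(Q)`, `Q = {u ↮ a₂}`, `W = P(R)`, `R = {u ↮ a₂, u ↮ c}`, `D = P(PD)`, `PD = R ∩ {a₂ ↮ c}`,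
`t = P(T)`, `T = R ∩ {a₂ ↔ c}`, `T′ = Q ∩ {u ↔ c}`, `Y = P(R, oL)`, `Y_N = P(PD, oL)`, `Y_t = P(T, oL)`,
`B = P(Q, bL)`, `B₀ = P(PD, bL) + P(T′, bL) = P(Q, a₂ ↮ c, bL)`, `B₁ = P(T, bL)`, `M = P(T, oL, bL)`).
RootLeafUYBFWB reduced `(F_W)` to the statement `(b)`; `(b)` is FALSE on the tie class `M = 0`
(engine D332 addendum 4 and p4 g12, two seats two codes: six cells of the two-valued {1,127}/128
family at n = 7), so the statement of record on the tie class is `(F_W)` itself there, which reads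
(`M = 0`)

  **`(MULT)`: `P(X̄ | R, oL) · P(X̄ | Q, bL) ≥ P(X̄ | R)`**, cleared:
  **`t·B₀·Y_N ≥ D·(B₀·Y_t + B₁·Y_N + B₁·Y_t)`**

(census: 0 violations on the engine's 1,185,724,848 `M = 0` cells; FALSE on some `M > 0` cells).
Here `(MULT)` in its cleared form is shown to imply `(F_W)` for EVERY instance (the term
`(Z + W)·D·M ≥ 0` is dropped, so no `M = 0` hypothesis is needed for the implication — it is only
where `(MULT)` is true): `FW_of_MULT`, `YB_nonneg_of_MULT`, `T2oL_nonneg_of_MULT`,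
`HCov_root_leaf_u_of_MULT`.  The identity `mult_slack_eq` records the form
`B₀·δ_o − D·B₁·Y` of the `(MULT)` slack (`δ_o = t·Y_N − D·Y_t ≥ 0` is BHK06 Thm 1.4, `ToL_mul_D_le`).
Conditional theorems: the hypothesis `(MULT)` is census-true on the tie class and unproved.
-/

namespace Summit.Ventures.PercRepro2

open UnionCluster CovForm

namespace RootLeafU

namespace YBF

section AlgebraMult

variable {R : Type*} [Field R] [LinearOrder R] [IsStrictOrderedRing R]

omit [LinearOrder R] [IsStrictOrderedRing R] in
/-- The `(MULT)` slack in the form `B₀·δ_o − D·B₁·Y`: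
`t·B₀·Y_N − D·(B₀·Y_t + B₁·Y_N + B₁·Y_t) = B₀·(t·Y_N − D·Y_t) − D·B₁·(Y_N + Y_t)`. -/
lemma mult_slack_eq (D t YN Yt bN B1 bp : R) :
    t * (bN + bp) * YN - D * ((bN + bp) * Yt + B1 * YN + B1 * Yt) =
      (bN + bp) * (t * YN - D * Yt) - D * B1 * (YN + Yt) := by
  ring

/-- **The algebra of `(F_W)` from `(MULT)`**: with `B₀ = b_N + b′`, `B = b_N + B₁ + b′`, `W = D + t`,
`Z = D + t + t′`, `Y = Y_N + Y_t`, the cleared `(MULT)` `D·(B₀·Y_t + B₁·Y_N + B₁·Y_t) ≤ t·B₀·Y_N`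
gives `D·B·Y ≤ (Z + W)·D·M + W·Y_N·B₀` (the `M`-term is a product of non-negative masses). -/
lemma fw_of_mult_alg {D t tp YN Yt bN B1 bp M : R} (hD : 0 ≤ D) (ht : 0 ≤ t) (htp : 0 ≤ tp)
    (hM : 0 ≤ M)
    (hmult : D * ((bN + bp) * Yt + B1 * YN + B1 * Yt) ≤ t * (bN + bp) * YN) :
    D * (bN + B1 + bp) * (YN + Yt) ≤
      (D + t + tp + (D + t)) * D * M + (D + t) * YN * (bN + bp) := by
  have h0 : 0 ≤ (D + t + tp + (D + t)) * D * M :=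
    mul_nonneg (mul_nonneg (by linarith) hD) hM
  nlinarith [hmult, h0]

end AlgebraMult

section ReductionMult

variable {V : Type*} {E : Type*} [Fintype E] [DecidableEq E] [Fintype V] [DecidableEq V]
  {R : Type*} [Field R] [LinearOrder R] [IsStrictOrderedRing R]

variable (p : E → R) (ends : E → Sym2 V) (o a₂ c b u : V)

omit [Fintype V] in
/-- **`(F_W)` from `(MULT)`**, for every instance: the cleared `(MULT)`
`P(PD)·(B₀·P(T, oL) + P(T, bL)·P(PD, oL) + P(T, bL)·P(T, oL)) ≤ P(T)·B₀·P(PD, oL)`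
(`B₀ = P(PD, bL) + P(T′, bL)`) implies the hypothesis `(F_W)` of `YB_nonneg_of_FW`. -/
theorem FW_of_MULT (hp : IsProbVec p)
    (hmult : prob p (PDEvent ends u a₂ c) *
        ((prob p (PDEvent ends u a₂ c ∩ connEvent ends u b) +
            prob p (TEvent ends a₂ u c ∩ connEvent ends u b)) *
          prob p (TEvent ends u a₂ c ∩ connEvent ends u o) +
          prob p (TEvent ends u a₂ c ∩ connEvent ends u b) *
            prob p (PDEvent ends u a₂ c ∩ connEvent ends u o) +
          prob p (TEvent ends u a₂ c ∩ connEvent ends u b) *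
            prob p (TEvent ends u a₂ c ∩ connEvent ends u o)) ≤
      prob p (TEvent ends u a₂ c) *
        (prob p (PDEvent ends u a₂ c ∩ connEvent ends u b) +
          prob p (TEvent ends a₂ u c ∩ connEvent ends u b)) *
        prob p (PDEvent ends u a₂ c ∩ connEvent ends u o)) :
    prob p (PDEvent ends u a₂ c) * prob p (avoidAll ends a₂ {u} ∩ connEvent ends u b) *
        prob p (avoidAll ends u {a₂, c} ∩ connEvent ends u o) ≤
      (prob p (avoidAll ends a₂ {u}) + prob p (avoidAll ends u {a₂, c})) * prob p (PDEvent ends u a₂ c) *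
          prob p (TEvent ends u a₂ c ∩ (connEvent ends u o ∩ connEvent ends u b)) +
        prob p (avoidAll ends u {a₂, c}) * prob p (PDEvent ends u a₂ c ∩ connEvent ends u o) *
          (prob p (PDEvent ends u a₂ c ∩ connEvent ends u b) +
            prob p (TEvent ends a₂ u c ∩ connEvent ends u b)) := by
  -- the splits `R = PD ⊔ T`, `Q = PD ⊔ T ⊔ T′`
  have hW : prob p (avoidAll ends u {a₂, c}) =
      prob p (PDEvent ends u a₂ c) + prob p (TEvent ends u a₂ c) := by
    have h' := ISplit.prob_PD_add_T p ends u a₂ c Set.univ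
    simp only [Set.inter_univ] at h'
    exact h'.symm
  have hY : prob p (avoidAll ends u {a₂, c} ∩ connEvent ends u o) =
      prob p (PDEvent ends u a₂ c ∩ connEvent ends u o) +
        prob p (TEvent ends u a₂ c ∩ connEvent ends u o) :=
    (ISplit.prob_PD_add_T p ends u a₂ c (connEvent ends u o)).symm
  have hZ := Qsplit_univ p ends u a₂ c
  have hB := Qsplit p ends u a₂ c (connEvent ends u b)
  rw [hW, hY, hZ, hB]
  exact fw_of_mult_alg (prob_nonneg hp _) (prob_nonneg hp _) (prob_nonneg hp _)
    (prob_nonneg hp _) hmult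

omit [Fintype V] in
/-- **`(YB) ≥ 0` from `(MULT)`**. -/
theorem YB_nonneg_of_MULT (hp : IsProbVec p)
    (hmult : prob p (PDEvent ends u a₂ c) *
        ((prob p (PDEvent ends u a₂ c ∩ connEvent ends u b) +
            prob p (TEvent ends a₂ u c ∩ connEvent ends u b)) *
          prob p (TEvent ends u a₂ c ∩ connEvent ends u o) +
          prob p (TEvent ends u a₂ c ∩ connEvent ends u b) *
            prob p (PDEvent ends u a₂ c ∩ connEvent ends u o) +
          prob p (TEvent ends u a₂ c ∩ connEvent ends u b) *
            prob p (TEvent ends u a₂ c ∩ connEvent ends u o)) ≤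
      prob p (TEvent ends u a₂ c) *
        (prob p (PDEvent ends u a₂ c ∩ connEvent ends u b) +
          prob p (TEvent ends a₂ u c ∩ connEvent ends u b)) *
        prob p (PDEvent ends u a₂ c ∩ connEvent ends u o)) :
    0 ≤ (prob p (avoidAll ends a₂ {c}) * prob p (avoidAll ends a₂ {u}) + prob p (PDEvent ends u a₂ c)) *
          prob p (TEvent ends u a₂ c ∩ (connEvent ends u o ∩ connEvent ends u b)) +
        prob p (PDEvent ends u a₂ c ∩ connEvent ends u o) *
          (prob p (PDEvent ends u a₂ c ∩ connEvent ends u b) +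
            prob p (TEvent ends a₂ u c ∩ connEvent ends u b)) -
        prob p (avoidAll ends a₂ {c}) * prob p (avoidAll ends a₂ {u} ∩ connEvent ends u b) *
          (prob p (PDEvent ends u a₂ c ∩ connEvent ends u o) +
            prob p (TEvent ends u a₂ c ∩ connEvent ends u o)) :=
  YB_nonneg_of_FW p ends o a₂ c b u hp (FW_of_MULT p ends o a₂ c b u hp hmult)

/-- **`0 ≤ T2oL` from `(MULT)`** — the `o ∈ L` half of W1 = `0 ≤ T2` on the tie class, as a kernel
hypothesis. -/
theorem T2oL_nonneg_of_MULT (hp : IsProbVec p)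
    (hmult : prob p (PDEvent ends u a₂ c) *
        ((prob p (PDEvent ends u a₂ c ∩ connEvent ends u b) +
            prob p (TEvent ends a₂ u c ∩ connEvent ends u b)) *
          prob p (TEvent ends u a₂ c ∩ connEvent ends u o) +
          prob p (TEvent ends u a₂ c ∩ connEvent ends u b) *
            prob p (PDEvent ends u a₂ c ∩ connEvent ends u o) +
          prob p (TEvent ends u a₂ c ∩ connEvent ends u b) *
            prob p (TEvent ends u a₂ c ∩ connEvent ends u o)) ≤
      prob p (TEvent ends u a₂ c) *
        (prob p (PDEvent ends u a₂ c ∩ connEvent ends u b) +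
          prob p (TEvent ends a₂ u c ∩ connEvent ends u b)) *
        prob p (PDEvent ends u a₂ c ∩ connEvent ends u o)) :
    0 ≤ T2oL p ends o a₂ c b u :=
  T2oL_nonneg_of_FW p ends o a₂ c b u hp (FW_of_MULT p ends o a₂ c b u hp hmult)

/-- **(G4-u) from `(MULT)` and the `o ∈ K` half** for the root `a₁` a leaf at the unmarked `u`. -/
theorem HCov_root_leaf_u_of_MULT (hp : IsProbVec p) {f : E} {a₁ : V} (hf : ends f = s(a₁, u))
    (hleaf : ∀ e, a₁ ∈ ends e → e = f) (h1u : a₁ ≠ u) (h12 : a₁ ≠ a₂) (h1c : a₁ ≠ c)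
    (h1o : a₁ ≠ o) (h1b : a₁ ≠ b)
    (hmult : prob p (PDEvent ends u a₂ c) *
        ((prob p (PDEvent ends u a₂ c ∩ connEvent ends u b) +
            prob p (TEvent ends a₂ u c ∩ connEvent ends u b)) *
          prob p (TEvent ends u a₂ c ∩ connEvent ends u o) +
          prob p (TEvent ends u a₂ c ∩ connEvent ends u b) *
            prob p (PDEvent ends u a₂ c ∩ connEvent ends u o) +
          prob p (TEvent ends u a₂ c ∩ connEvent ends u b) *
            prob p (TEvent ends u a₂ c ∩ connEvent ends u o)) ≤
      prob p (TEvent ends u a₂ c) *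
        (prob p (PDEvent ends u a₂ c ∩ connEvent ends u b) +
          prob p (TEvent ends a₂ u c ∩ connEvent ends u b)) *
        prob p (PDEvent ends u a₂ c ∩ connEvent ends u o))
    (hK : 0 ≤ T2oK p ends o a₂ c b u) (h3 : HCov p ends o u a₂ c b) : HCov p ends o a₁ a₂ c b :=
  HCov_root_leaf_u_of_FW p ends o a₂ c b u hp hf hleaf h1u h12 h1c h1o h1b
    (FW_of_MULT p ends o a₂ c b u hp hmult) hK h3

end ReductionMult

end YBF

end RootLeafU

end Summit.Ventures.PercRepro2
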